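import Summits.CriticalPhenomena.PercolationContinuityZ3.Theorems.PercNearOneGluingNoHeavyLowerTailSunflowerMultiPetalKempeMarkedTIPayers
import HarnessLib
import HarnessLib.Audit

/-!
# `NoHeavyLowerTail` (crux stmt-CriticalPhenomena-4575), marked multigraphs, THEOREM TI2: the WEIGHTED HEART — for outer degree `|S| ≥ 2` the weighted
# cell residuals of the law `TI(K) ≥ TI(K−y) + TI((K−y)/(S∪u))` sum to a nonnegative number (both weight colours, `s` far or near)

Support file (seat `prim-l12-p2` gen 52; `--supports stmt-CriticalPhenomena-4575`; continuation of `…KempeMarkedTIPayers` and of g47's `…KempeMarkedHeart` (p596349)).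
No `sorry`; nothing is asserted about the crux.  Memo: run/shared/lean/prim/prim-l12/prim-l12-p2/PROOF-TI2-MARKED-MULTIGRAPHS-g51.md §3 (cases (d), (e), `d ≥ 2`;
the flat charging below also covers `d = 2`, which the memo did by enumeration).

* `psi_injOn_pat` — g47's charging map `ψ` is injective on the colourings carrying one of the four deficit PATTERNS on `S` (the 16-case analysis of p596349,
  stated pattern-wise so that it serves the `K`-cells and the `K⁺`-cells at once);
* **`sum_resW_nonneg`** — `0 ≤ Σ_{ρ u = 0, ρ v = 1} resW_c ρ` for `c ∈ {0,1}`, terminals `u ≠ v`, an unmarked `y ∼ u` with `y ∉ {u,v,s}`, `s ≠ u`, `|S| ≥ 2`.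
  Deficits: `K`-cells of g47's families D1/D2/D4/D5 (value `−2`) and, for `c = 1`, D4 cells of `K⁺ᵛ` (value `−1`); `ψ` sends each to a cell of weighted value
  `≥ 2` (resp. `≥ 1`): a `K`-cell pays twice g47's value, a `K⁺`-cell pays by `…TIPayers`.  With `sum_resW_eq` and the contraction bookkeeping of `…TICells`
  this is the step law for `TI` at every `y ∼ u` of outer degree `≥ 2`.
-/

namespace Summit.CriticalPhenomena.PercolationContinuityZ3.Theorems.SunflowerPartition.Kempe

open Finset

namespace MGraph

variable {V : Type*} [Fintype V] [LinearOrder V] (K : MGraph V)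

section Heart

variable {K}
variable {u v y s : V} {S : Finset V}

/-- **`ψ` is injective on the pattern cells** (the four deficit patterns on `S`: all `2`, all `1`, all `0` but one `2`, all `0` but one `1`; `|S| ≥ 2`, `u ∉ S`).
[this work] -/
theorem psi_injOn_pat (huS : u ∉ S) (htwo : 2 ≤ S.card) : Set.InjOn (psi u S) {ρ : V → Fin 3 |
    (∀ s ∈ S, ρ s = 2) ∨ (∀ s ∈ S, ρ s = 1) ∨ (∃ s₀ ∈ S, ρ s₀ = 2 ∧ ∀ s ∈ S, s ≠ s₀ → ρ s = 0) ∨ (∃ s₀ ∈ S, ρ s₀ = 1 ∧ ∀ s ∈ S, s ≠ s₀ → ρ s = 0)} := by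
  classical
  intro ρ₁ h₁ ρ₂ h₂ heq
  rw [Set.mem_setOf_eq] at h₁ h₂
  have hne : S.Nonempty := card_pos.1 (by omega)
  have pat : ∀ ρ : V → Fin 3, ((∀ s ∈ S, ρ s = 2) ∨ (∀ s ∈ S, ρ s = 1) ∨ (∃ s₀ ∈ S, ρ s₀ = 2 ∧ ∀ s ∈ S, s ≠ s₀ → ρ s = 0) ∨ (∃ s₀ ∈ S, ρ s₀ = 1 ∧ ∀ s ∈ S, s ≠ s₀ → ρ s = 0)) →
      ((∀ s ∈ S, ρ s = 2) ∧ psi u S ρ = phiU u ρ ∧ (∀ s ∈ S, psi u S ρ s = 0)) ∨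
      ((∀ s ∈ S, ρ s = 1) ∧ psi u S ρ = phiU u ρ ∧ (∀ s ∈ S, psi u S ρ s = 1)) ∨
      (∃ s₀ ∈ S, ρ s₀ = 2 ∧ (∀ s ∈ S, s ≠ s₀ → ρ s = 0) ∧ psi u S ρ = Function.update ρ s₀ 1 ∧
          psi u S ρ s₀ = 1 ∧ (∀ s ∈ S, s ≠ s₀ → psi u S ρ s = 0)) ∨
      (∃ s₀ ∈ S, ρ s₀ = 1 ∧ (∀ s ∈ S, s ≠ s₀ → ρ s = 0) ∧ psi u S ρ = Function.update (phiU u ρ) s₀ 0 ∧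
          psi u S ρ s₀ = 0 ∧ (∀ s ∈ S, s ≠ s₀ → psi u S ρ s = 2)) := by
    intro ρ hρ
    rcases hρ with hall | hall | ⟨s₀, hs₀, hc₀, hrest⟩ | ⟨s₀, hs₀, hc₀, hrest⟩
    · refine Or.inl ⟨hall, psi_of_all ρ (Or.inl hall), fun s hs => ?_⟩
      rw [psi_of_all ρ (Or.inl hall), phiU_of_ne u ρ (fun h => huS (h ▸ hs)), hall s hs]; decide
    · refine Or.inr (Or.inl ⟨hall, psi_of_all ρ (Or.inr hall), fun s hs => ?_⟩)
      rw [psi_of_all ρ (Or.inr hall), phiU_of_ne u ρ (fun h => huS (h ▸ hs)), hall s hs]; decide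
    · refine Or.inr (Or.inr (Or.inl ⟨s₀, hs₀, hc₀, hrest, psi_of_D4 htwo ρ hs₀ hc₀ hrest, ?_, fun s hs hss => ?_⟩))
      · rw [psi_of_D4 htwo ρ hs₀ hc₀ hrest, Function.update_self]
      · rw [psi_of_D4 htwo ρ hs₀ hc₀ hrest, Function.update_of_ne hss, hrest s hs hss]
    · refine Or.inr (Or.inr (Or.inr ⟨s₀, hs₀, hc₀, hrest, psi_of_D5 htwo ρ hs₀ hc₀ hrest, ?_, fun s hs hss => ?_⟩))
      · rw [psi_of_D5 htwo ρ hs₀ hc₀ hrest, Function.update_self]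
      · rw [psi_of_D5 htwo ρ hs₀ hc₀ hrest, Function.update_of_ne hss, phiU_of_ne u ρ (fun h => huS (h ▸ hs)), hrest s hs hss]; decide
  obtain ⟨s₁, hs₁⟩ := hne
  have two : ∀ s₀ ∈ S, ∃ s ∈ S, s ≠ s₀ := fun s₀ _ => by
    by_contra hno; push Not at hno
    have : S.card ≤ 1 := card_le_one.2 fun a ha b hb => by rw [hno a ha, hno b hb]
    omega
  rcases pat ρ₁ h₁ with ⟨a1, e1, p1⟩ | ⟨a1, e1, p1⟩ | ⟨s₀, hs₀, c1, r1, e1, p1, q1⟩ | ⟨s₀, hs₀, c1, r1, e1, p1, q1⟩ <;>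
    rcases pat ρ₂ h₂ with ⟨a2, e2, p2⟩ | ⟨a2, e2, p2⟩ | ⟨t₀, ht₀, c2, r2, e2, p2, q2⟩ | ⟨t₀, ht₀, c2, r2, e2, p2, q2⟩
  · rw [e1, e2] at heq; have := congrArg (phiU u) heq; rwa [phiU_phiU, phiU_phiU] at this
  · exfalso; have := p1 s₁ hs₁; rw [heq, p2 s₁ hs₁] at this; exact absurd this (by decide)
  · exfalso; have := p1 t₀ ht₀; rw [heq, p2] at this; exact absurd this (by decide)
  · exfalso; obtain ⟨s, hs, hss⟩ := two t₀ ht₀; have := p1 s hs; rw [heq, q2 s hs hss] at this; exact absurd this (by decide)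
  · exfalso; have := p1 s₁ hs₁; rw [heq, p2 s₁ hs₁] at this; exact absurd this (by decide)
  · rw [e1, e2] at heq; have := congrArg (phiU u) heq; rwa [phiU_phiU, phiU_phiU] at this
  · exfalso; obtain ⟨s, hs, hss⟩ := two t₀ ht₀; have := p1 s hs; rw [heq, q2 s hs hss] at this; exact absurd this (by decide)
  · exfalso; have := p1 t₀ ht₀; rw [heq, p2] at this; exact absurd this (by decide)
  · exfalso; have := p2 s₀ hs₀; rw [← heq, p1] at this; exact absurd this (by decide)
  · exfalso; obtain ⟨s, hs, hss⟩ := two s₀ hs₀; have := p2 s hs; rw [← heq, q1 s hs hss] at this; exact absurd this (by decide)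
  · have hst : s₀ = t₀ := by
      by_contra hne; have := q2 s₀ hs₀ hne; rw [← heq, p1] at this; exact absurd this (by decide)
    subst hst
    funext w
    by_cases hw : w = s₀
    · rw [hw, c1, c2]
    · have := congrFun heq w; rwa [e1, e2, Function.update_of_ne hw, Function.update_of_ne hw] at this
  · exfalso; have := p1; rw [heq] at this
    by_cases hst : s₀ = t₀
    · rw [hst, p2] at this; exact absurd this (by decide)
    · rw [q2 s₀ hs₀ hst] at this; exact absurd this (by decide)
  · exfalso; obtain ⟨s, hs, hss⟩ := two s₀ hs₀; have := p2 s hs; rw [← heq, q1 s hs hss] at this; exact absurd this (by decide)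
  · exfalso; obtain ⟨s, hs, hss⟩ := two s₀ hs₀; have := p2 s hs; rw [← heq, q1 s hs hss] at this; exact absurd this (by decide)
  · exfalso; have := p2; rw [← heq] at this
    by_cases hst : t₀ = s₀
    · rw [hst, p1] at this; exact absurd this (by decide)
    · rw [q1 t₀ ht₀ hst] at this; exact absurd this (by decide)
  · have hst : s₀ = t₀ := by
      by_contra hne; have := q2 s₀ hs₀ hne; rw [← heq, p1] at this; exact absurd this (by decide)
    subst hst
    have hφ : phiU u ρ₁ = phiU u ρ₂ := by
      funext w
      by_cases hw : w = s₀
      · by_cases hwu : s₀ = u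
        · exact absurd (hwu ▸ hs₀) huS
        · rw [hw, phiU_of_ne u ρ₁ hwu, phiU_of_ne u ρ₂ hwu, c1, c2]
      · have := congrFun heq w; rwa [e1, e2, Function.update_of_ne hw, Function.update_of_ne hw] at this
    have := congrArg (phiU u) hφ; rwa [phiU_phiU, phiU_phiU] at this

/-- A `K`-deficit carries a pattern. [this work] -/
theorem defPat_of_resCell_neg (hS : ∀ w, w ∈ S ↔ (w ≠ u ∧ w ≠ v ∧ w ≠ y ∧ K.mul y w ≠ 0)) (huv : u ≠ v) (hyu : y ≠ u) (hyv : y ≠ v)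
    (hmy : K.mark y = 0) (hyu' : K.mul y u ≠ 0) (htwo : 2 ≤ S.card) (ρ : V → Fin 3) (hu : ρ u = 0) (hv : ρ v = 1)
    (hneg : K.resCell y S ρ < 0) :
    ((∀ s ∈ S, ρ s = 2) ∨ (∀ s ∈ S, ρ s = 1) ∨ (∃ s₀ ∈ S, ρ s₀ = 2 ∧ ∀ s ∈ S, s ≠ s₀ → ρ s = 0) ∨ (∃ s₀ ∈ S, ρ s₀ = 1 ∧ ∀ s ∈ S, s ≠ s₀ → ρ s = 0)) := by
  rcases resCell_neg_cases hS huv hyu hyv hmy hyu' htwo ρ hu hv hneg with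
    ⟨hall, -, -, -⟩ | ⟨hall, -, -⟩ | ⟨s₀, hs₀, hc₀, -, hrest, -, -⟩ | ⟨s₀, hs₀, hc₀, -, hrest, -, -⟩
  · exact Or.inl hall
  · exact Or.inr (Or.inl hall)
  · exact Or.inr (Or.inr (Or.inl ⟨s₀, hs₀, hc₀, hrest⟩))
  · exact Or.inr (Or.inr (Or.inr ⟨s₀, hs₀, hc₀, hrest⟩))

/-- `sw02 z = 0 ↔ z = 2`. (finite check) [this work] -/
theorem sw02_eq_zero_iff' : ∀ z : Fin 3, sw02 z = 0 ↔ z = 2 := by decide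

/-- **THE WEIGHTED HEART, weight at `u`** (`c = 0`): `0 ≤ Σ resW₀`.  The `K⁺ᵘ`-cells have no deficits; the `K`-deficits (value `−2`) are charged by `ψ` to
cells of weighted value `≥ 2`. [this work] -/
theorem sum_resW_nonneg_zero (hS : ∀ w, w ∈ S ↔ (w ≠ u ∧ w ≠ v ∧ w ≠ y ∧ K.mul y w ≠ 0)) (huv : u ≠ v) (hyu : y ≠ u) (hyv : y ≠ v)
    (hmy : K.mark y = 0) (hyu' : K.mul y u ≠ 0) (htwo : 2 ≤ S.card) :
    0 ≤ ∑ ρ ∈ univ.filter (fun ρ : V → Fin 3 => ρ u = 0 ∧ ρ v = 1), K.resW 0 y S s u v ρ := by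
  set F := univ.filter (fun ρ : V → Fin 3 => ρ u = 0 ∧ ρ v = 1) with hF
  have memF : ∀ ρ, ρ ∈ F ↔ ρ u = 0 ∧ ρ v = 1 := fun ρ => by rw [hF, mem_filter]; simp
  have hne : S.Nonempty := card_pos.1 (by omega)
  have huS : u ∉ S := fun h => ((hS u).1 h).1 rfl
  have hw0 : wterm (0 : Fin 3) u v = u := by unfold wterm; rw [if_pos rfl]
  have hresK : ∀ ρ : V → Fin 3, ρ s ≠ 0 → K.resW 0 y S s u v ρ = 2 * K.resCell y S ρ := fun ρ h => by unfold resW; rw [if_neg h]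
  have hresP : ∀ ρ : V → Fin 3, ρ s = 0 → K.resW 0 y S s u v ρ = (K.addMark u 1).resCell y S ρ := fun ρ h => by unfold resW; rw [if_pos h, hw0]
  -- a deficit is a K-cell of g47's families
  have hdef : ∀ ρ ∈ F, K.resW 0 y S s u v ρ < 0 → ρ s ≠ 0 ∧ K.resCell y S ρ < 0 ∧ K.resW 0 y S s u v ρ = -2 := by
    intro ρ hρ hneg
    obtain ⟨hu, hv⟩ := (memF ρ).1 hρ
    by_cases hs0 : ρ s = 0
    · exfalso
      rw [hresP ρ hs0] at hneg
      exact absurd (resCell_addMark_fst_nonneg hS huv hyu hyv hmy hyu' htwo ρ hu hv) (not_le.2 hneg)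
    · rw [hresK ρ hs0] at hneg ⊢
      have hneg' : K.resCell y S ρ < 0 := by linarith
      refine ⟨hs0, hneg', ?_⟩
      rw [resCell_eq_neg_one_of_neg hS huv hyu hyv hmy hyu' htwo ρ hu hv hneg']; norm_num
  refine sum_nonneg_of_charging F (K.resW 0 y S s u v) (psi u S) (fun ρ hρ hneg => ?_) ?_
  · obtain ⟨hu, hv⟩ := (memF ρ).1 hρ
    obtain ⟨hs0, hnegK, hval⟩ := hdef ρ hρ hneg
    rw [hval]
    have hφu : phiU u ρ u = 0 := by rw [phiU_self, hu]
    have hφv : phiU u ρ v = 1 := by rw [phiU_of_ne u ρ huv.symm, hv]; decide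
    rcases resCell_neg_cases hS huv hyu hyv hmy hyu' htwo ρ hu hv hnegK with
      ⟨hall, hu1, hv0, ht⟩ | ⟨hall, hu1, ht⟩ | ⟨s₀, hs₀, hc₀, hm₀, hrest, hv0, ht⟩ | ⟨s₀, hs₀, hc₀, hm₀, hrest, hv0, ht⟩
    · rw [psi_of_all ρ (Or.inl hall)]
      refine ⟨(memF _).2 ⟨hφu, hφv⟩, ?_⟩
      by_cases hz : phiU u ρ s = 0
      · rw [hresP _ hz, resCell_addMark_phiU_of_D1 hS huv hyu hyv hmy hyu' hne ρ hu hv hall hv0 ht]; norm_num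
      · rw [hresK _ hz, resCell_phiU_of_D1 hS huv hyu hyv hmy hyu' hne ρ hu hv hall hv0 ht]; norm_num
    · rw [psi_of_all ρ (Or.inr hall)]
      refine ⟨(memF _).2 ⟨hφu, hφv⟩, ?_⟩
      by_cases hz : phiU u ρ s = 0
      · rw [hresP _ hz, resCell_addMark_phiU_of_D2 hS huv hyu hyv hmy htwo ρ hu hv hall hu1 ht]; norm_num
      · rw [hresK _ hz, resCell_phiU_of_D2 hS huv hyu hyv hmy htwo ρ hu hv hall hu1 ht]; norm_num
    · obtain ⟨hs₀u, hs₀v, -, -⟩ := (hS s₀).1 hs₀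
      rw [psi_of_D4 htwo ρ hs₀ hc₀ hrest]
      refine ⟨(memF _).2 ⟨by rw [Function.update_of_ne hs₀u.symm, hu], by rw [Function.update_of_ne hs₀v.symm, hv]⟩, ?_⟩
      have hz : Function.update ρ s₀ 1 s ≠ 0 := by
        by_cases hss : s = s₀
        · rw [hss, Function.update_self]; decide
        · rw [Function.update_of_ne hss]; exact hs0
      rw [hresK _ hz, resCell_sibling_of_D4 hS huv hyu hyv hmy hyu' htwo ρ hu hv hs₀ hc₀ hm₀ hrest hv0 ht]; norm_num
    · obtain ⟨hs₀u, hs₀v, -, -⟩ := (hS s₀).1 hs₀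
      rw [psi_of_D5 htwo ρ hs₀ hc₀ hrest]
      refine ⟨(memF _).2 ⟨by rw [Function.update_of_ne hs₀u.symm, hφu], by rw [Function.update_of_ne hs₀v.symm, hφv]⟩, ?_⟩
      by_cases hz : Function.update (phiU u ρ) s₀ 0 s = 0
      · rw [hresP _ hz, resCell_addMark_partner_of_D5 hS huv hyu hyv hmy hyu' htwo ρ hu hv hs₀ hc₀ hm₀ hrest hv0 ht]; norm_num
      · rw [hresK _ hz]
        have := one_le_resCell_partner_of_D5 hS huv hyu hyv hmy hyu' htwo ρ hu hv hs₀ hc₀ hm₀ hrest hv0 ht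
        linarith
  · -- injectivity: deficits carry patterns
    refine (psi_injOn_pat huS htwo).mono fun ρ hρ => ?_
    rw [mem_coe, mem_filter] at hρ
    obtain ⟨hu, hv⟩ := (memF ρ).1 hρ.1
    exact defPat_of_resCell_neg hS huv hyu hyv hmy hyu' htwo ρ hu hv (hdef ρ hρ.1 hρ.2).2.1

/-- **THE WEIGHTED HEART, weight at `v`** (`c = 1`): `0 ≤ Σ resW₁`.  Besides the `K`-deficits (value `−2`), the D4 cells of `K⁺ᵛ` (value `−1`) are deficits;
`ψ` charges everything to cells of weighted value `≥ 2` resp. `≥ 1`. [this work] -/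
theorem sum_resW_nonneg_one (hS : ∀ w, w ∈ S ↔ (w ≠ u ∧ w ≠ v ∧ w ≠ y ∧ K.mul y w ≠ 0)) (huv : u ≠ v) (hyu : y ≠ u) (hyv : y ≠ v) (hsu : s ≠ u)
    (hmy : K.mark y = 0) (hyu' : K.mul y u ≠ 0) (htwo : 2 ≤ S.card) :
    0 ≤ ∑ ρ ∈ univ.filter (fun ρ : V → Fin 3 => ρ u = 0 ∧ ρ v = 1), K.resW 1 y S s u v ρ := by
  set F := univ.filter (fun ρ : V → Fin 3 => ρ u = 0 ∧ ρ v = 1) with hF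
  have memF : ∀ ρ, ρ ∈ F ↔ ρ u = 0 ∧ ρ v = 1 := fun ρ => by rw [hF, mem_filter]; simp
  have hne : S.Nonempty := card_pos.1 (by omega)
  have huS : u ∉ S := fun h => ((hS u).1 h).1 rfl
  have hw1 : wterm (1 : Fin 3) u v = v := by unfold wterm; rw [if_neg (by decide)]
  have hresK : ∀ ρ : V → Fin 3, ρ s ≠ 1 → K.resW 1 y S s u v ρ = 2 * K.resCell y S ρ := fun ρ h => by unfold resW; rw [if_neg h]
  have hresP : ∀ ρ : V → Fin 3, ρ s = 1 → K.resW 1 y S s u v ρ = (K.addMark v 1).resCell y S ρ := fun ρ h => by unfold resW; rw [if_pos h, hw1]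
  have hmy' : (K.addMark v 1).mark y = 0 := by rw [mark_addMark_of_ne _ v 1 hyv, hmy]
  have hyu'' : (K.addMark v 1).mul y u ≠ 0 := by rw [mul_addMark]; exact hyu'
  have s1 : ∀ z : Fin 3, sw02 z = 1 ↔ z = 1 := sw02_eq_one_iff
  refine sum_nonneg_of_charging F (K.resW 1 y S s u v) (psi u S) (fun ρ hρ hneg => ?_) ?_
  · obtain ⟨hu, hv⟩ := (memF ρ).1 hρ
    have hφu : phiU u ρ u = 0 := by rw [phiU_self, hu]
    have hφv : phiU u ρ v = 1 := by rw [phiU_of_ne u ρ huv.symm, hv]; decide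
    by_cases hs1 : ρ s = 1
    · -- a K⁺ᵛ-deficit: D4 in K⁺ᵛ, paid by the sibling (still a K⁺ᵛ-cell)
      rw [hresP ρ hs1] at hneg ⊢
      obtain ⟨⟨s₀, hs₀, hc₀, hm₀, hrest, hv0, ht⟩, hval⟩ := resCell_addMark_snd_neg hS huv hyu hyv hmy hyu' htwo ρ hu hv hneg
      obtain ⟨hs₀u, hs₀v, -, -⟩ := (hS s₀).1 hs₀
      rw [hval, psi_of_D4 htwo ρ hs₀ hc₀ hrest]
      refine ⟨(memF _).2 ⟨by rw [Function.update_of_ne hs₀u.symm, hu], by rw [Function.update_of_ne hs₀v.symm, hv]⟩, ?_⟩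
      have hss : s ≠ s₀ := fun e => by rw [e, hc₀] at hs1; exact absurd hs1 (by decide)
      have hz : Function.update ρ s₀ 1 s = 1 := by rw [Function.update_of_ne hss, hs1]
      rw [hresP _ hz, resCell_sibling_of_D4 (hS_addMark hS v 1) huv hyu hyv hmy' hyu'' htwo ρ hu hv hs₀ hc₀ hm₀ hrest hv0 ht]; norm_num
    · -- a K-deficit
      rw [hresK ρ hs1] at hneg
      have hnegK : K.resCell y S ρ < 0 := by linarith
      have hval : K.resW 1 y S s u v ρ = -2 := by
        rw [hresK ρ hs1, resCell_eq_neg_one_of_neg hS huv hyu hyv hmy hyu' htwo ρ hu hv hnegK]; norm_num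
      rw [hval]
      rcases resCell_neg_cases hS huv hyu hyv hmy hyu' htwo ρ hu hv hnegK with
        ⟨hall, hu1, hv0, ht⟩ | ⟨hall, hu1, ht⟩ | ⟨s₀, hs₀, hc₀, hm₀, hrest, hv0, ht⟩ | ⟨s₀, hs₀, hc₀, hm₀, hrest, hv0, ht⟩
      · rw [psi_of_all ρ (Or.inl hall)]
        refine ⟨(memF _).2 ⟨hφu, hφv⟩, ?_⟩
        have hz : phiU u ρ s ≠ 1 := by rw [phiU_of_ne u ρ hsu]; exact fun h => hs1 ((s1 _).1 h)
        rw [hresK _ hz, resCell_phiU_of_D1 hS huv hyu hyv hmy hyu' hne ρ hu hv hall hv0 ht]; norm_num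
      · rw [psi_of_all ρ (Or.inr hall)]
        refine ⟨(memF _).2 ⟨hφu, hφv⟩, ?_⟩
        have hz : phiU u ρ s ≠ 1 := by rw [phiU_of_ne u ρ hsu]; exact fun h => hs1 ((s1 _).1 h)
        rw [hresK _ hz, resCell_phiU_of_D2 hS huv hyu hyv hmy htwo ρ hu hv hall hu1 ht]; norm_num
      · obtain ⟨hs₀u, hs₀v, -, -⟩ := (hS s₀).1 hs₀
        rw [psi_of_D4 htwo ρ hs₀ hc₀ hrest]
        refine ⟨(memF _).2 ⟨by rw [Function.update_of_ne hs₀u.symm, hu], by rw [Function.update_of_ne hs₀v.symm, hv]⟩, ?_⟩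
        by_cases hz : Function.update ρ s₀ 1 s = 1
        · rw [hresP _ hz, resCell_addMark_sibling_of_D4 hS huv hyu hyv hmy hyu' htwo ρ hu hv hs₀ hc₀ hm₀ hrest hv0 ht]; norm_num
        · rw [hresK _ hz, resCell_sibling_of_D4 hS huv hyu hyv hmy hyu' htwo ρ hu hv hs₀ hc₀ hm₀ hrest hv0 ht]; norm_num
      · obtain ⟨hs₀u, hs₀v, -, -⟩ := (hS s₀).1 hs₀
        rw [psi_of_D5 htwo ρ hs₀ hc₀ hrest]
        refine ⟨(memF _).2 ⟨by rw [Function.update_of_ne hs₀u.symm, hφu], by rw [Function.update_of_ne hs₀v.symm, hφv]⟩, ?_⟩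
        have hz : Function.update (phiU u ρ) s₀ 0 s ≠ 1 := by
          by_cases hss : s = s₀
          · rw [hss, Function.update_self]; decide
          · rw [Function.update_of_ne hss, phiU_of_ne u ρ hsu]; exact fun h => hs1 ((s1 _).1 h)
        rw [hresK _ hz]
        have := one_le_resCell_partner_of_D5 hS huv hyu hyv hmy hyu' htwo ρ hu hv hs₀ hc₀ hm₀ hrest hv0 ht
        linarith
  · refine (psi_injOn_pat huS htwo).mono fun ρ hρ => ?_
    rw [mem_coe, mem_filter] at hρ
    obtain ⟨hu, hv⟩ := (memF ρ).1 hρ.1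
    simp only [Set.mem_setOf_eq]
    by_cases hs1 : ρ s = 1
    · have hneg := hρ.2
      rw [hresP ρ hs1] at hneg
      obtain ⟨⟨s₀, hs₀, hc₀, -, hrest, -, -⟩, -⟩ := resCell_addMark_snd_neg hS huv hyu hyv hmy hyu' htwo ρ hu hv hneg
      exact Or.inr (Or.inr (Or.inl ⟨s₀, hs₀, hc₀, hrest⟩))
    · have hneg := hρ.2
      rw [hresK ρ hs1] at hneg
      exact defPat_of_resCell_neg hS huv hyu hyv hmy hyu' htwo ρ hu hv (by linarith)

/-- **THE WEIGHTED HEART** for both weight colours `c ∈ {0,1}`. [this work] -/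
theorem sum_resW_nonneg (c : Fin 3) (hc : c = 0 ∨ c = 1) (hS : ∀ w, w ∈ S ↔ (w ≠ u ∧ w ≠ v ∧ w ≠ y ∧ K.mul y w ≠ 0)) (huv : u ≠ v) (hyu : y ≠ u)
    (hyv : y ≠ v) (hsu : s ≠ u) (hmy : K.mark y = 0) (hyu' : K.mul y u ≠ 0) (htwo : 2 ≤ S.card) :
    0 ≤ ∑ ρ ∈ univ.filter (fun ρ : V → Fin 3 => ρ u = 0 ∧ ρ v = 1), K.resW c y S s u v ρ := by
  rcases hc with h | h
  · subst h; exact sum_resW_nonneg_zero hS huv hyu hyv hmy hyu' htwo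
  · subst h; exact sum_resW_nonneg_one hS huv hyu hyv hsu hmy hyu' htwo

end Heart

end MGraph

end Summit.CriticalPhenomena.PercolationContinuityZ3.Theorems.SunflowerPartition.Kempe
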